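import Literature.Geometry.Kaehler.AnalyticSetProjection
import Mathlib.Analysis.Calculus.MeanValue
import HarnessLib

/-!
# Lipschitz graph pieces of the regular part of an analytic set

Support for the proof of Lelong's theorem on the locally finite `𝓗^{2p}`-measure of complex
analytic sets (`Literature/Geometry/Kaehler/HolomorphicChainFacts.lean`,
`Lelong1957_hausdorffMeasure_inter_lt_top`). At a regular point `a` of codimension `q` of a set
`A ⊆ V` (`dim V = q + p`), the tangent space `T_a A = ker df(a)` is a complex `p`-plane; if a
linear surjection `ℓ : V → ℂᵖ` is *quantitatively transverse* to it, `‖v‖ ≤ C ‖ℓ v‖` on `T_a A`,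
then near `a` the set `A` is the graph over `ℓ` of a holomorphic section `s` (implicit function
theorem, `Literature.Geometry.Kaehler.SCV.isGraphPointOver_of_isCompl_ker`) whose differential at
`ℓ a` is the inverse of `ℓ|_{T_a A}`, hence of norm `≤ C`; by continuity of `ds` the section is
`(C + 1)`-Lipschitz on a ball, so that a neighbourhood of `a` in `A` is a `(C + 1)`-Lipschitz image
of its (injective) projection:

* `exists_lipschitz_graph_nhds` — the local statement at one regular point;
* `exists_countable_lipschitz_graph_cover` — given finitely many surjections `ℓ k` such that
  every `p`-plane is quantitatively transverse to one of them (cf.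
  `Literature/Geometry/Kaehler/UniformTransversePlane.lean`), the regular points of codimension `q`
  of `A` in an open set `Ω` are covered by countably many open sets `W`, each with an index `k`
  and a section `s` of `ℓ k`, `(C + 1)`-Lipschitz on `ℓ k '' W`, with `s (ℓ k z) = z` on `A ∩ W`,
  all points of `A ∩ W` being regular of codimension `q`.

Theorems only, in the model-space language (`Literature.Geometry.Kaehler.SCV.IsRegPt`).

## References

* E. M. Chirka, *Complex Analytic Sets*, Kluwer (1989), §2.3 (regular points, Prop. 2–3), A2.2
  (implicit functions) [Chirka1989].
-/

open scoped Topology NNReal Manifold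
open Set Filter Metric

namespace Literature.Geometry.Kaehler
namespace SCV

variable {V : Type*} [NormedAddCommGroup V] [NormedSpace ℂ V] [FiniteDimensional ℂ V]

/-- **Lipschitz graph neighbourhood of a regular point.** Let `A ∩ U = {f = 0} ∩ U` near `a ∈ A`
with `f : V → ℂ^q` holomorphic on the open `U` and `df(a)` onto, `dim V = q + p`, and let
`ℓ : V → ℂᵖ` be a linear surjection with `‖v‖ ≤ C ‖ℓ v‖` on `ker df(a)`. Then there are an open
`W ∋ a` inside `U` and a map `s : ℂᵖ → V`, `(C + 1)`-Lipschitz on `ℓ '' W`, with `s (ℓ z) = z`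
for all `z ∈ A ∩ W`; moreover every point of `A ∩ W` is a graph point of `A` over `ℓ`.
[Chirka, *Complex Analytic Sets*, §2.3 Prop. 3, A2.2] [folklore] -/
theorem exists_lipschitz_graph_nhds {p q : ℕ} {ℓ : V →L[ℂ] (Fin p → ℂ)}
    (hℓ : Function.Surjective ℓ) (hdim : Module.finrank ℂ V = q + p) {A U : Set V} {a : V}
    (hU : IsOpen U) (haU : a ∈ U) {f : V → (Fin q → ℂ)} (hf : DifferentiableOn ℂ f U)
    (hAU : A ∩ U = U ∩ f ⁻¹' {0}) (haA : a ∈ A) (hsurj : Function.Surjective (fderiv ℂ f a))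
    {C : ℝ≥0}
    (hC : ∀ v ∈ LinearMap.ker (fderiv ℂ f a : V →ₗ[ℂ] (Fin q → ℂ)), ‖v‖ ≤ C * ‖ℓ v‖) :
    ∃ W : Set V, IsOpen W ∧ a ∈ W ∧ W ⊆ U ∧ ∃ s : (Fin p → ℂ) → V,
      LipschitzOnWith (C + 1) s (ℓ '' W) ∧ (∀ z ∈ A ∩ W, s (ℓ z) = z) ∧
      ∀ z ∈ A ∩ W, IsGraphPointOver ℓ A z := by
  -- the tangent space and its complement `ker ℓ`
  set T : Submodule ℂ V := LinearMap.ker (fderiv ℂ f a : V →ₗ[ℂ] (Fin q → ℂ)) with hTdef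
  set K : Submodule ℂ V := LinearMap.ker (ℓ : V →ₗ[ℂ] (Fin p → ℂ)) with hKdef
  have hTp : Module.finrank ℂ T = p := by
    have h := finrank_ker_of_surjective (fderiv ℂ f a : V →ₗ[ℂ] (Fin q → ℂ)) hsurj
    rw [hTdef]; omega
  have hKq : Module.finrank ℂ K = q := by
    have h := finrank_ker_of_surjective (ℓ : V →ₗ[ℂ] (Fin p → ℂ)) hℓ
    rw [hKdef]; omega
  have hinf : T ⊓ K = ⊥ := by
    rw [Submodule.eq_bot_iff]
    rintro v ⟨hvT, hvK⟩
    have hℓv : ℓ v = 0 := hvK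
    have h := hC v hvT
    rw [hℓv, norm_zero, mul_zero] at h
    exact norm_le_zero_iff.1 h
  have hcompl : IsCompl T K :=
    isCompl_of_inf_eq_bot_of_finrank_add_eq hinf (by rw [hTp, hKq, hdim, add_comm])
  -- the graph structure
  obtain ⟨V₁, hV₁, haV₁, V', hV', hV₁V', s, hs, hℓs, hAV₁⟩ :=
    isGraphPointOver_of_isCompl_ker hU haU hf hAU haA hsurj hℓ hcompl
  have hsa : s (ℓ a) = a := (hAV₁.subset ⟨haA, haV₁⟩).2
  have hℓaV' : ℓ a ∈ V' := hV₁V' haV₁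
  have hsd : DifferentiableAt ℂ s (ℓ a) := hs.differentiableAt (hV'.mem_nhds hℓaV')
  -- `f ∘ s = 0` and `ℓ ∘ s = id` near `ℓ a`
  have hN : ∀ᶠ z' in 𝓝 (ℓ a), z' ∈ V' ∧ s z' ∈ V₁ ∩ U := by
    refine (hV'.eventually_mem hℓaV').and ?_
    have hc : ContinuousAt s (ℓ a) := hsd.continuousAt
    have : V₁ ∩ U ∈ 𝓝 (s (ℓ a)) := by
      rw [hsa]; exact (hV₁.inter hU).mem_nhds ⟨haV₁, haU⟩
    exact hc.preimage_mem_nhds this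
  have hfs : (f ∘ s) =ᶠ[𝓝 (ℓ a)] fun _ => 0 := by
    filter_upwards [hN] with z' hz'
    have hz'A : s z' ∈ A := by
      have : s z' ∈ {z ∈ V₁ | s (ℓ z) = z} := ⟨hz'.2.1, by rw [hℓs z' hz'.1]⟩
      rw [← hAV₁] at this
      exact this.1
    exact (hAU.subset ⟨hz'A, hz'.2.2⟩).2
  have hℓs' : (ℓ ∘ s) =ᶠ[𝓝 (ℓ a)] id := by
    filter_upwards [hV'.mem_nhds hℓaV'] with z' hz'
    exact hℓs z' hz'
  -- hence `range ds(ℓ a) ⊆ T` and `ℓ ∘ ds(ℓ a) = id`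
  have hfa : HasFDerivAt f (fderiv ℂ f a) (s (ℓ a)) := by
    rw [hsa]; exact (hf.differentiableAt (hU.mem_nhds haU)).hasFDerivAt
  have hcomp0 : HasFDerivAt (f ∘ s) ((fderiv ℂ f a).comp (fderiv ℂ s (ℓ a))) (ℓ a) :=
    hfa.comp (ℓ a) hsd.hasFDerivAt
  have hzero : (fderiv ℂ f a).comp (fderiv ℂ s (ℓ a)) = 0 := by
    have h0 : HasFDerivAt (f ∘ s) (0 : (Fin p → ℂ) →L[ℂ] (Fin q → ℂ)) (ℓ a) :=
      (hasFDerivAt_const (0 : Fin q → ℂ) (ℓ a)).congr_of_eventuallyEq hfs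
    exact hcomp0.unique h0
  have hid : ℓ.comp (fderiv ℂ s (ℓ a)) = ContinuousLinearMap.id ℂ (Fin p → ℂ) := by
    have h1 : HasFDerivAt (ℓ ∘ s) (ℓ.comp (fderiv ℂ s (ℓ a))) (ℓ a) :=
      ℓ.hasFDerivAt.comp (ℓ a) hsd.hasFDerivAt
    have h2 : HasFDerivAt (ℓ ∘ s) (ContinuousLinearMap.id ℂ (Fin p → ℂ)) (ℓ a) :=
      (hasFDerivAt_id (ℓ a)).congr_of_eventuallyEq hℓs'
    exact h1.unique h2
  have hnorm : ‖fderiv ℂ s (ℓ a)‖ ≤ C := by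
    refine ContinuousLinearMap.opNorm_le_bound _ C.2 fun w => ?_
    have hwT : fderiv ℂ s (ℓ a) w ∈ T := by
      rw [hTdef, LinearMap.mem_ker, ContinuousLinearMap.coe_coe]
      have := congrArg (fun L : (Fin p → ℂ) →L[ℂ] (Fin q → ℂ) => L w) hzero
      simpa using this
    have hℓw : ℓ (fderiv ℂ s (ℓ a) w) = w := by
      have := congrArg (fun L : (Fin p → ℂ) →L[ℂ] (Fin p → ℂ) => L w) hid
      simpa using this
    calc ‖fderiv ℂ s (ℓ a) w‖ ≤ C * ‖ℓ (fderiv ℂ s (ℓ a) w)‖ := hC _ hwT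
      _ = C * ‖w‖ := by rw [hℓw]
  -- continuity of `ds` on `V'`: `‖ds‖ < C + 1` on a ball around `ℓ a` inside `V'`
  have hcont : ContinuousOn (fderiv ℂ s) V' :=
    (Literature.Analysis.Complex.SCV.contDiffOn_one hs hV').continuousOn_fderiv_of_isOpen hV'
      le_rfl
  have hlt : ∀ᶠ z' in 𝓝 (ℓ a), ‖fderiv ℂ s z'‖₊ < C + 1 := by
    have hca : ContinuousAt (fderiv ℂ s) (ℓ a) := hcont.continuousAt (hV'.mem_nhds hℓaV')
    have hlt0 : ‖fderiv ℂ s (ℓ a)‖₊ < C + 1 := by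
      have : ‖fderiv ℂ s (ℓ a)‖₊ ≤ C := hnorm
      exact lt_of_le_of_lt this (lt_add_one C)
    exact hca.nnnorm.eventually (gt_mem_nhds hlt0)
  obtain ⟨ρ, hρ, hball⟩ : ∃ ρ > 0, ball (ℓ a) ρ ⊆ V' ∩ {z' | ‖fderiv ℂ s z'‖₊ < C + 1} :=
    Metric.mem_nhds_iff.1 (Filter.inter_mem (hV'.mem_nhds hℓaV') hlt)
  have hlip : LipschitzOnWith (C + 1) s (ball (ℓ a) ρ) :=
    (convex_ball (ℓ a) ρ).lipschitzOnWith_of_nnnorm_fderiv_le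
      (fun z' hz' => hs.differentiableAt (hV'.mem_nhds (hball hz').1))
      (fun z' hz' => (hball hz').2.le)
  -- the neighbourhood `W`
  refine ⟨V₁ ∩ U ∩ ℓ ⁻¹' ball (ℓ a) ρ,
    (hV₁.inter hU).inter (isOpen_ball.preimage ℓ.continuous),
    ⟨⟨haV₁, haU⟩, mem_ball_self hρ⟩, fun z hz => hz.1.2, s, ?_, ?_, ?_⟩
  · refine hlip.mono ?_
    rintro _ ⟨z, hz, rfl⟩
    exact hz.2
  · rintro z ⟨hzA, ⟨hzV₁, -⟩, -⟩
    exact (hAV₁.subset ⟨hzA, hzV₁⟩).2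
  · rintro z ⟨-, ⟨hzV₁, -⟩, -⟩
    exact ⟨V₁, hV₁, hzV₁, V', hV', hV₁V', s, hs, hℓs, hAV₁⟩

/-- At a regular point of codimension `q` (`dim V = q + p`), a finite family of surjections
`ℓ k : V → ℂᵖ` to one of which every `p`-plane is `C`-transverse provides an index `k` and a
Lipschitz graph neighbourhood for `ℓ k` (`exists_lipschitz_graph_nhds`). [folklore] -/
theorem exists_lipschitz_graph_nhds_of_isRegPt {κ : Type*} {p q : ℕ}
    (ℓ : κ → V →L[ℂ] (Fin p → ℂ)) (hℓ : ∀ k, Function.Surjective (ℓ k))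
    (hdim : Module.finrank ℂ V = q + p) {C : ℝ≥0}
    (hC : ∀ T : Submodule ℂ V, Module.finrank ℂ T = p → ∃ k, ∀ v ∈ T, ‖v‖ ≤ C * ‖ℓ k v‖)
    {A Ω : Set V} (hΩ : IsOpen Ω) {a : V} (haΩ : a ∈ Ω) (haA : a ∈ A) (ha : IsRegPt A q a) :
    ∃ k, ∃ W : Set V, IsOpen W ∧ a ∈ W ∧ W ⊆ Ω ∧ ∃ s : (Fin p → ℂ) → V,
      LipschitzOnWith (C + 1) s (ℓ k '' W) ∧ (∀ z ∈ A ∩ W, s (ℓ k z) = z) ∧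
      ∀ z ∈ A ∩ W, IsGraphPointOver (ℓ k) A z := by
  obtain ⟨U, hU, haU, g, hg, hAU, hsurj⟩ := ha
  -- shrink `U` into `Ω`
  have hU' : IsOpen (U ∩ Ω) := hU.inter hΩ
  have hAU' : A ∩ (U ∩ Ω) = (U ∩ Ω) ∩ g ⁻¹' {0} := by
    calc A ∩ (U ∩ Ω) = (A ∩ U) ∩ Ω := by rw [inter_assoc]
      _ = (U ∩ g ⁻¹' {0}) ∩ Ω := by rw [hAU]
      _ = (U ∩ Ω) ∩ g ⁻¹' {0} := by ac_rfl
  have hTp : Module.finrank ℂ (LinearMap.ker (fderiv ℂ g a : V →ₗ[ℂ] (Fin q → ℂ))) = p := by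
    have h := finrank_ker_of_surjective (fderiv ℂ g a : V →ₗ[ℂ] (Fin q → ℂ)) hsurj
    omega
  obtain ⟨k, hk⟩ := hC _ hTp
  obtain ⟨W, hW, haW, hWU, s, hs, hsec, hgr⟩ := exists_lipschitz_graph_nhds (hℓ k) hdim hU'
    ⟨haU, haΩ⟩ (hg.mono inter_subset_left) hAU' haA hsurj hk
  exact ⟨k, W, hW, haW, fun z hz => (hWU hz).2, s, hs, hsec, hgr⟩

/-- A graph point over a surjection `ℓ : V → ℂᵖ`, `dim V = q + p`, is a regular point of
codimension `q` (model-space form). [folklore] -/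
theorem IsGraphPointOver.isRegPt {p q : ℕ} {ℓ : V →L[ℂ] (Fin p → ℂ)}
    (hℓ : Function.Surjective ℓ) (hdim : Module.finrank ℂ V = q + p) {A : Set V} {z : V}
    (h : IsGraphPointOver ℓ A z) : IsRegPt A q z := by
  have hKq : Module.finrank ℂ (LinearMap.ker (ℓ : V →ₗ[ℂ] (Fin p → ℂ))) = q := by
    have h := finrank_ker_of_surjective (ℓ : V →ₗ[ℂ] (Fin p → ℂ)) hℓ
    omega
  have hr := h.isRegularPointOfCodim
  rw [hKq] at hr
  exact isRegularPointOfCodim_iff_isRegPt.1 hr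

/-- **Countable Lipschitz graph cover of the regular part.** Let `ℓ k : V → ℂᵖ` (`k ∈ κ`) be
linear surjections, `dim V = q + p`, such that every `p`-plane `T` has a `k` with
`‖v‖ ≤ C ‖ℓ k v‖` on `T`. For `A ⊆ V` and `Ω` open there is a countable set `R₀` of regular points
of codimension `q` of `A` in `Ω` and, for each `x ∈ R₀`, an open `W x ⊆ Ω`, an index `k x` and a
map `s x : ℂᵖ → V`, `(C + 1)`-Lipschitz on `ℓ (k x) '' W x`, with `s x (ℓ (k x) z) = z` on
`A ∩ W x`, every point of `A ∩ W x` regular of codimension `q`, and the `W x` covering all regular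
points of codimension `q` of `A` in `Ω` (second countability). [folklore] -/
theorem exists_countable_lipschitz_graph_cover {κ : Type*} [Nonempty κ] {p q : ℕ}
    (ℓ : κ → V →L[ℂ] (Fin p → ℂ)) (hℓ : ∀ k, Function.Surjective (ℓ k))
    (hdim : Module.finrank ℂ V = q + p) {C : ℝ≥0}
    (hC : ∀ T : Submodule ℂ V, Module.finrank ℂ T = p → ∃ k, ∀ v ∈ T, ‖v‖ ≤ C * ‖ℓ k v‖)
    (A : Set V) {Ω : Set V} (hΩ : IsOpen Ω) :
    ∃ R₀ : Set V, R₀.Countable ∧ R₀ ⊆ {x ∈ A ∩ Ω | IsRegPt A q x} ∧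
      ∃ (W : V → Set V) (k : V → κ) (s : V → (Fin p → ℂ) → V),
        (∀ x ∈ R₀, IsOpen (W x) ∧ x ∈ W x ∧ W x ⊆ Ω ∧
          LipschitzOnWith (C + 1) (s x) (ℓ (k x) '' W x) ∧
          (∀ z ∈ A ∩ W x, s x (ℓ (k x) z) = z) ∧ ∀ z ∈ A ∩ W x, IsRegPt A q z) ∧
        {x ∈ A ∩ Ω | IsRegPt A q x} ⊆ ⋃ x ∈ R₀, W x := by
  classical
  set R : Set V := {x ∈ A ∩ Ω | IsRegPt A q x} with hR
  -- local data at every point of `R`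
  have hloc : ∀ x ∈ R, ∃ k, ∃ W : Set V, IsOpen W ∧ x ∈ W ∧ W ⊆ Ω ∧ ∃ s : (Fin p → ℂ) → V,
      LipschitzOnWith (C + 1) s (ℓ k '' W) ∧ (∀ z ∈ A ∩ W, s (ℓ k z) = z) ∧
      ∀ z ∈ A ∩ W, IsGraphPointOver (ℓ k) A z := fun x hx =>
    exists_lipschitz_graph_nhds_of_isRegPt ℓ hℓ hdim hC hΩ hx.1.2 hx.1.1 hx.2
  choose! k W hWo hxW hWΩ s hs hsec hgr using hloc
  -- extend by the empty set off `R` and extract a countable subcover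
  set W' : V → Set V := fun x => if x ∈ R then W x else ∅ with hW'
  have hW'o : ∀ x, IsOpen (W' x) := fun x => by
    by_cases hx : x ∈ R
    · simp only [hW', if_pos hx]; exact hWo x hx
    · simp only [hW', if_neg hx]; exact isOpen_empty
  obtain ⟨T₀, hT₀c, hT₀⟩ := TopologicalSpace.isOpen_iUnion_countable W' hW'o
  refine ⟨T₀ ∩ R, hT₀c.mono inter_subset_left, inter_subset_right, W, k, s, ?_, ?_⟩
  · intro x hx
    exact ⟨hWo x hx.2, hxW x hx.2, hWΩ x hx.2, hs x hx.2, hsec x hx.2,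
      fun z hz => (hgr x hx.2 z hz).isRegPt (hℓ (k x)) hdim⟩
  · intro y hy
    have hyU : y ∈ ⋃ x, W' x := mem_iUnion.2 ⟨y, by simp only [hW', if_pos hy]; exact hxW y hy⟩
    rw [← hT₀] at hyU
    obtain ⟨x, hxT₀, hyx⟩ := mem_iUnion₂.1 hyU
    have hxR : x ∈ R := by
      by_contra hxR
      simp only [hW', if_neg hxR] at hyx
      exact hyx
    refine mem_iUnion₂.2 ⟨x, ⟨hxT₀, hxR⟩, ?_⟩
    simpa only [hW', if_pos hxR] using hyx

end SCV
end Literature.Geometry.Kaehler
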